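import Summits.Ventures.PercRepro.C026PFunHalfEM
import Summits.Ventures.PercRepro.C026PFunStar
import Summits.Ventures.PercRepro.C026DCSub

/-!
# The `k = 2` all-corner state of `(P)` is the C-026 class slack (p6, gen 17; mine-3 §36 (a))

Read a skeleton with probe `c` and two live vertices `a, b` (every other vertex bare) as the
cell's marked multigraph `(G; a, b, c)`, open edges = red.  At the **all-corner state** — the live
vertices at `(x, K) = (0, 0)`, the bare vertices (the probe included) at `(1, 1)`, i.e. the cells
`liveCells a b = [v ∉ {a, b}]` — the `(P)` functional over the whole edge set is an integer count:

`(P)(0, 0) = 2 · slackCF a b c + #{ω : c ~_ω a ∧ c ~_ω b}`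

(mine-3 §35 (b) / §36 (a): `(E_0) = 2|B| + 2n(B,C) + n(D,·) − 2n(A,D) = 2·Δ_CF + n(D,·)`), where
`slackCF a b c = #ab|c + #ac|b + #bc|a − #N_AB` is the C-026 class slack of the tree (p5,
`C026DCSub`).  Hence the corner identity `(E00)` of THEOREM L2 is implied by `(CF)`, the cell's
row C-026 at the class level, on the skeleton.

The proof is the `5 × 5` type matrix: at these cells every factor of the configuration sum is
`1`, `2` or `4` according to the red / blue connection pattern of `c, a, b`
(`xCluster_liveCells`, `nbar_liveCells`, `nbarOff_liveCells`), and after the complement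
symmetrisation `∑ f(ω) = ∑ f(ωᶜ)` (`sum_compl_config_eq`) the identity holds configuration by
configuration (`corner_summand_add_compl`).
-/

namespace PercRepro

namespace MultiGraph

open Finset

variable {V E : Type*} [Fintype V] [DecidableEq V]

/-- The all-corner cells with live vertices `a, b`: `0` at `a` and `b`, `1` elsewhere (used for
both the `x`- and the `K`-cells). -/
noncomputable def liveCells (a b : V) : V → ℝ := fun v => if v = a ∨ v = b then 0 else 1

omit [Fintype V] in
/-- The product of the corner cells over a vertex set is `0` iff the set meets `{a, b}`. -/
theorem prod_liveCells (a b : V) (R : Finset V) :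
    ∏ v ∈ R, liveCells a b v = if a ∈ R ∨ b ∈ R then 0 else 1 := by
  split_ifs with h
  · rcases h with h | h
    · exact Finset.prod_eq_zero h (by simp [liveCells])
    · exact Finset.prod_eq_zero h (by simp [liveCells])
  · refine Finset.prod_eq_one fun v hv => ?_
    simp only [liveCells]
    rw [if_neg]
    rintro (rfl | rfl)
    · exact h (Or.inl hv)
    · exact h (Or.inr hv)

variable {G : MultiGraph V E}

open Classical in
/-- `X_c` at the corner cells: `0` iff `c` is joined to a live vertex. -/
theorem xCluster_liveCells (a b c : V) (ω : Config E) :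
    G.xCluster (liveCells a b) c ω = if G.Conn ω c a ∨ G.Conn ω c b then 0 else 1 := by
  unfold xCluster
  rw [prod_liveCells]
  simp only [mem_clusterF]

open Classical in
/-- `K_c` at the corner cells: the same as `X_c`. -/
theorem kCluster_liveCells (a b c : V) (ω : Config E) :
    G.kCluster (liveCells a b) c ω = if G.Conn ω c a ∨ G.Conn ω c b then 0 else 1 := by
  unfold kCluster
  rw [prod_liveCells]
  simp only [mem_clusterF]

open Classical in
/-- `n̄` at the corner cells: `2` if the live vertices are joined, else `4`. -/
theorem nbar_liveCells (a b : V) (ω : Config E) :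
    G.nbar (liveCells a b) ω = if G.Conn ω a b then 2 else 4 := by
  unfold nbar
  have h1 : ∀ R ∈ G.clusters ω,
      (2 - ∏ v ∈ R, liveCells a b v) = if a ∈ R ∨ b ∈ R then (2 : ℝ) else 1 := by
    intro R _
    rw [prod_liveCells]
    split_ifs <;> norm_num
  rw [Finset.prod_congr rfl h1, Finset.prod_ite, Finset.prod_const_one, mul_one,
    Finset.prod_const]
  have h2 : (G.clusters ω).filter (fun R => a ∈ R ∨ b ∈ R) =
      {G.clusterF ω a, G.clusterF ω b} := by
    ext R
    simp only [Finset.mem_filter, Finset.mem_insert, Finset.mem_singleton]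
    constructor
    · rintro ⟨hR, h | h⟩
      · exact Or.inl (clusterF_eq_of_mem hR h).symm
      · exact Or.inr (clusterF_eq_of_mem hR h).symm
    · rintro (rfl | rfl)
      · exact ⟨clusterF_mem_clusters ω a, Or.inl (self_mem_clusterF ω a)⟩
      · exact ⟨clusterF_mem_clusters ω b, Or.inr (self_mem_clusterF ω b)⟩
  rw [h2]
  by_cases hab : G.Conn ω a b
  · rw [if_pos hab, clusterF_eq_of_conn hab, Finset.pair_eq_singleton, Finset.card_singleton]
    norm_num
  · rw [if_neg hab, Finset.card_pair (fun h => hab (conn_of_clusterF_eq h))]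
    norm_num

open Classical in
/-- `N_c` at the corner cells, by `n̄ = (2 − X_c)·N_c`. -/
theorem nbarOff_liveCells (a b c : V) (ω : Config E) :
    G.nbarOff (liveCells a b) c ω =
      if G.Conn ω c a ∨ G.Conn ω c b then (if G.Conn ω a b then 1 else 2)
      else (if G.Conn ω a b then 2 else 4) := by
  have h := G.nbar_eq_mul_nbarOff (liveCells a b) c ω
  rw [nbar_liveCells, xCluster_liveCells] at h
  split_ifs at h ⊢ <;> linarith

variable [Fintype E] [DecidableEq E]

omit [Fintype V] [DecidableEq V] [Fintype E] [DecidableEq E] in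
/-- The complement of a configuration, pointwise. -/
theorem config_compl_eq_not (ω : Config E) : ωᶜ = fun e => !ω e := by
  funext e
  rw [Pi.compl_apply]
  cases ω e <;> rfl

omit [Fintype V] [DecidableEq V] in
/-- Complementation is a bijection of the configurations (`sum_complIn_eq` over the full edge
set). -/
theorem sum_compl_config_eq (f : Config E → ℝ) : ∑ ω, f ωᶜ = ∑ ω, f ω := by
  have h := sum_complIn_eq (univ : Finset E) f
  rw [configsIn_univ] at h
  simpa only [complIn_univ, config_compl_eq_not] using h

omit [Fintype E] [DecidableEq E] in
open Classical in
/-- The type-matrix identity, configuration by configuration after symmetrisation: the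
`(P)`-summand of `ω` plus that of `ωᶜ` equals the C-026 summand of `ω` plus that of `ωᶜ`. -/
theorem corner_summand_add_compl (a b c : V) (ω : Config E) :
    (G.nbarOff (liveCells a b) c ω * (1 - 2 * G.xCluster (liveCells a b) c ω) +
        G.kCluster (liveCells a b) c ω * G.nbar (liveCells a b) ωᶜ) +
      (G.nbarOff (liveCells a b) c ωᶜ * (1 - 2 * G.xCluster (liveCells a b) c ωᶜ) +
        G.kCluster (liveCells a b) c ωᶜ * G.nbar (liveCells a b) ωᶜᶜ) =
    (2 * ((if G.Conn ω a b ∧ ¬ G.Conn ω a c then (1 : ℝ) else 0) +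
          (if G.Conn ω c a ∧ ¬ G.Conn ω c b then (1 : ℝ) else 0) +
          (if G.Conn ω c b ∧ ¬ G.Conn ω c a then (1 : ℝ) else 0) -
          (if G.Conn ω a b ∧ ¬ G.Conn ωᶜ c a ∧ ¬ G.Conn ωᶜ c b then (1 : ℝ) else 0)) +
        (if G.Conn ω c a ∧ G.Conn ω c b then (1 : ℝ) else 0)) +
      (2 * ((if G.Conn ωᶜ a b ∧ ¬ G.Conn ωᶜ a c then (1 : ℝ) else 0) +
          (if G.Conn ωᶜ c a ∧ ¬ G.Conn ωᶜ c b then (1 : ℝ) else 0) +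
          (if G.Conn ωᶜ c b ∧ ¬ G.Conn ωᶜ c a then (1 : ℝ) else 0) -
          (if G.Conn ωᶜ a b ∧ ¬ G.Conn ωᶜᶜ c a ∧ ¬ G.Conn ωᶜᶜ c b then (1 : ℝ) else 0)) +
        (if G.Conn ωᶜ c a ∧ G.Conn ωᶜ c b then (1 : ℝ) else 0)) := by
  rw [compl_compl, nbarOff_liveCells, nbarOff_liveCells, xCluster_liveCells, xCluster_liveCells,
    kCluster_liveCells, kCluster_liveCells, nbar_liveCells, nbar_liveCells]
  -- the red pattern
  have r1 : G.Conn ω c a → G.Conn ω c b → G.Conn ω a b := fun h1 h2 => h1.symm.trans h2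
  have r2 : G.Conn ω c a → G.Conn ω a b → G.Conn ω c b := fun h1 h2 => h1.trans h2
  have r3 : G.Conn ω c b → G.Conn ω a b → G.Conn ω c a := fun h1 h2 => h1.trans h2.symm
  have r4 : G.Conn ω a c ↔ G.Conn ω c a := conn_comm
  -- the blue pattern
  have b1 : G.Conn ωᶜ c a → G.Conn ωᶜ c b → G.Conn ωᶜ a b := fun h1 h2 => h1.symm.trans h2
  have b2 : G.Conn ωᶜ c a → G.Conn ωᶜ a b → G.Conn ωᶜ c b := fun h1 h2 => h1.trans h2
  have b3 : G.Conn ωᶜ c b → G.Conn ωᶜ a b → G.Conn ωᶜ c a := fun h1 h2 => h1.trans h2.symm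
  have b4 : G.Conn ωᶜ a c ↔ G.Conn ωᶜ c a := conn_comm
  by_cases hra : G.Conn ω c a <;> by_cases hrb : G.Conn ω c b <;> by_cases hrab : G.Conn ω a b <;>
    by_cases hba : G.Conn ωᶜ c a <;> by_cases hbb : G.Conn ωᶜ c b <;>
    by_cases hbab : G.Conn ωᶜ a b <;> simp_all <;> norm_num

open Classical in
/-- `(P)` at the corner cells as a configuration sum of the C-026 summands (after the complement
symmetrisation). -/
theorem pFun_liveCells_eq_sum (a b c : V) :
    G.pFun c (liveCells a b) (liveCells a b) univ =
      ∑ ω : Config E, (2 * ((if G.Conn ω a b ∧ ¬ G.Conn ω a c then (1 : ℝ) else 0) +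
          (if G.Conn ω c a ∧ ¬ G.Conn ω c b then (1 : ℝ) else 0) +
          (if G.Conn ω c b ∧ ¬ G.Conn ω c a then (1 : ℝ) else 0) -
          (if G.Conn ω a b ∧ ¬ G.Conn ωᶜ c a ∧ ¬ G.Conn ωᶜ c b then (1 : ℝ) else 0)) +
        (if G.Conn ω c a ∧ G.Conn ω c b then (1 : ℝ) else 0)) := by
  have hsym : ∀ f : Config E → ℝ, ∑ ω, f ω = (∑ ω, (f ω + f ωᶜ)) / 2 := by
    intro f
    rw [Finset.sum_add_distrib, sum_compl_config_eq f]
    ring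
  unfold pFun
  rw [configsIn_univ]
  simp only [complIn_univ, ← config_compl_eq_not]
  rw [hsym]
  conv_rhs => rw [hsym]
  congr 1
  exact Finset.sum_congr rfl fun ω _ => corner_summand_add_compl a b c ω

open Classical in
/-- **The `k = 2` all-corner state of `(P)` is the C-026 class slack** (mine-3 §36 (a)): for the
skeleton read as the marked multigraph `(G; a, b, c)`, at the cells `liveCells a b`
(`x = K = 0` at the live vertices `a, b`, `x = K = 1` elsewhere, the probe bare),
`(P) = 2 · slackCF a b c + #{ω : c ~_ω a ∧ c ~_ω b}` — so `(CF)` on the skeleton implies the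
corner identity `(E00)` of THEOREM L2. -/
theorem pFun_liveCells_eq (a b c : V) :
    G.pFun c (liveCells a b) (liveCells a b) univ =
      2 * (G.slackCF a b c : ℝ) +
        ((univ.filter fun ω : Config E => G.Conn ω c a ∧ G.Conn ω c b).card : ℝ) := by
  rw [pFun_liveCells_eq_sum]
  unfold slackCF
  push_cast
  simp only [Finset.sum_add_distrib, Finset.sum_sub_distrib, ← Finset.mul_sum, Finset.sum_boole]
  -- the two `Fintype (Config E)` instances (p5's classical one, this file's) are subsingletons
  congr!

/-- **`(CF)` ⟹ `(E00)`**: if the C-026 class slack of the skeleton is nonnegative, the `k = 2`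
all-corner value of `(P)` is nonnegative. -/
theorem pFun_liveCells_nonneg_of_slackCF (a b c : V) (h : 0 ≤ G.slackCF a b c) :
    0 ≤ G.pFun c (liveCells a b) (liveCells a b) univ := by
  rw [pFun_liveCells_eq]
  have h' : (0 : ℝ) ≤ (G.slackCF a b c : ℝ) := by exact_mod_cast h
  positivity

end MultiGraph

end PercRepro
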